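import Literature.Barriers.Schanuel.NesterenkoModularScopeHolds
import Literature.Barriers.Schanuel.NesterenkoModularScopeValuesProofs
import Literature.Barriers.Schanuel.AlgebraicIndependenceOfLogarithms
import Literature.NumberTheory.Transcendental.PhilipponCriterionNesterenkoHolds
import Literature.NumberTheory.Transcendental.PhilipponCriterionProofs
import Mathlib.LinearAlgebra.Dual.Lemmas
import Mathlib.RingTheory.Localization.Integer
import HarnessLib

/-!
# Barrier (Schanuel) `NesterenkoModularScope`: Lemma 2.2 of LNM 1752 Ch. 3 discharged, the diagonal case of Theorem 2.3 over `ℂ`, and the tightness of "three" — proofs only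

`Literature/Barriers/Schanuel/NesterenkoModularScopeSeriesHolds.lean` — proofs only (no definitions,
no named facts, nothing asserted). Sibling of `NesterenkoModularScopeSeries.lean`, which vendors the
printed ingredients of Nesterenko's proof (LNM 1752 Ch. 3 §§2–3) as the named facts
`ramanujan1916_system`, `NesterenkoPhilippon2001_ch3_thm_2_3`, `…_lemma_3_1`, `…_lemma_3_4`,
`…_lemma_2_2`. Of these, the Ramanujan system, Lemma 3.1 and Lemma 3.4 are already theorems of the
tree (`ramanujan1916_system_holds`, `NesterenkoPhilippon2001_ch3_lemma_3_1_holds`,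
`NesterenkoPhilippon2001_ch3_lemma_3_4_holds`), and Lemma 2.2 was proved from Theorem 2.3
(`NesterenkoPhilippon2001_ch3_lemma_2_2_of_thm_2_3`) and from the integer diagonal multiplicity
estimate (DIAG) (`NesterenkoPhilippon2001_ch3_lemma_2_2_of_diagonalInt`). This file is the record of
the barrier audit of the Series file (gen 1, 2026-08-17):

1. **Lemma 2.2 discharged.** The printed proof of Lemma 2.2 (p. 37: "(9) and Theorem 2.3 applied
   with `L₁ = L₂ = N` imply `½N⁴ ≤ M ≤ cN⁴`") uses Theorem 2.3 only on the diagonal `L₁ = L₂ = N`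
   and only for the integer polynomial of Lemma 3.1 — i.e. exactly (DIAG) — and (DIAG) is a theorem
   of the tree: Proposition 3.6 of Ch. 10, projectivised over `ℚ` (`Transfer.prop36`,
   `NesterenkoModularScopeHolds.lean`), fed into the induction of Ch. 10 §4
   (`Transfer.diagonalInt_of_prop36`, `NesterenkoModularScopeInduction.lean`):
   `ramanujan_diagonalInt_multiplicity`, `NesterenkoPhilippon2001_ch3_lemma_2_2_holds`.
2. **The diagonal case of Theorem 2.3 over `ℂ`.** The order condition
   `ord_{z=0} A(z, P, Q, R) > B` is a system of linear equations with INTEGER coefficients in the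
   coefficients of `A` (the Taylor coefficients of `P, Q, R` are integers:
   `coeff_ramanujanComposite_sum_monomial`), so a non-zero complex solution yields a non-zero
   integer one with the same support (`exists_int_of_coeff_ramanujanComposite_eq_zero`: a
   `ℚ`-linear functional `ℂ → ℚ` non-zero on one coefficient, then clearing denominators). Hence
   (DIAG) over `ℤ` gives the complex-coefficient diagonal estimate `ord ≤ c N⁴` for all `N ≥ 1`
   (`ramanujan_diagonal_multiplicity`), i.e. Theorem 2.3 with `c · max(L₁, L₂)⁴` in place of
   `c L₁ L₂³` (`ramanujan_multiplicity_max_pow_four`). What remains un-discharged of the named fact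
   `NesterenkoPhilippon2001_ch3_thm_2_3` is only its OFF-DIAGONAL shape `c L₁ L₂³` (Nesterenko 1996,
   Theorem 3; Ch. 10 Theorem 1.1 over `ℂ(z)` with the bi-degree), which no declaration of the tree
   uses (conversely it gives the diagonal estimate, `diagonal_of_thm_2_3` of
   `NesterenkoModularScopeDiagonal.lean`).
3. **Why "three": the exponent `k + 1 = 3` of Theorem 2.1 cannot be raised at any point with an
   algebraic coordinate.** Lemma 2.2 delivers `λ(N) = N⁴` against `τ(N) = γ₀ N log² N`, so
   `λ/τ³ → ∞` but `λ/τ⁴ → 0`, and Theorem 2.1 (proved in the tree,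
   `NesterenkoPhilippon2001_ch3_thm_2_1_holds`) gives `trdeg ≥ 3`. A sequence with `λ/τ⁴ → ∞` at
   `ω̄(q) = (q, P(q), Q(q), R(q))` would give `trdeg ≥ 4` (`four_le_trdeg_of_sequence`); but
   `trdeg_ℚ ℚ(ω̄(q)) ≤ 3` as soon as one coordinate of `ω̄(q)` is algebraic
   (`trdeg_adjoin_ramanujanPoint_le_three_of_isAlgebraic`) — every algebraic `q` (where Theorem 1.1
   is then an equality, Cor. 1.4) and the CM points with `R(q) = 0` or `Q(q) = 0`, e.g. `q = e^{−2π}`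
   where `trdeg = 3` exactly (`trdeg_adjoin_ramanujanPoint_exp_neg_two_pi`, from `R(e^{−2π}) = 0`,
   `ramanujan_values_exp_neg_two_pi_holds`, and Theorem 1.1, `nesterenko1996_thm_1_1_holds`). So no
   such sequence exists there (`not_exists_sequence_of_isAlgebraic`,
   `not_exists_sequence_exp_neg_two_pi`, `not_exists_sequence_of_isAlgebraic_q`): any construction
   of auxiliary polynomials valid for all `0 < |q| < 1` — as Lemmas 3.1–3.4 are — is confined to
   `k = 2`, whatever its degrees and heights; a fourth algebraically independent number at a
   transcendental non-CM `q` (Conjecture 1.11) needs an input that fails at algebraic `q`. This is the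
   formal content of "we choose `n = 4, k = 2`" (p. 31) and of the axiomatised method's output
   `trdeg ≥ n − 1` for an `n`-dimensional ambient space [Fonseca 2019, Thm 1.2].

## References

* [NesterenkoPhilippon2001] Yu. V. Nesterenko, P. Philippon (eds.), *Introduction to Algebraic
  Independence Theory*, LNM 1752, Springer 2001, Ch. 3 Theorem 2.1, Lemma 2.2 (p. 31) and its proof
  (p. 37), Theorem 2.3 (p. 32), Corollary 1.4 (p. 28); Ch. 10 Theorem 1.3 (p. 151), Prop. 3.6
  (p. 157), §4 (pp. 161–162).
* [Nesterenko1996SbMath] Yu. V. Nesterenko, *Modular functions and transcendence questions*,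
  Sb. Math. 187 (1996) 1319–1348, Theorem 3.
* [Fonseca2019IntegralCurves] T. J. Fonseca, *Algebraic independence for values of integral curves*,
  Algebra & Number Theory 13 (2019) 643–694 = arXiv:1710.00563, Theorem 1.2 and §1.4.
-/

noncomputable section

open Complex MvPolynomial Filter Topology IntermediateField
open Literature.NumberTheory.Transcendental

namespace Literature.Barriers.Schanuel

/-! ### (DIAG) and Lemma 2.2 -/

/-- **The integer diagonal multiplicity estimate (DIAG), unconditionally**: there are `c, N₀` with
`ord_{z=0} A(z, P, Q, R) ≤ c N⁴` for every `N ≥ N₀` and every non-zero `A ∈ ℤ[z, x₁, x₂, x₃]` with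
`deg_z A, deg_{xᵢ} A ≤ N` — the case `L₁ = L₂ = N`, integer coefficients, of Ch. 3 Theorem 2.3, which
is all the printed proof of Lemma 2.2 uses; obtained from Prop. 3.6 of Ch. 10 (`Transfer.prop36`)
through the induction of Ch. 10 §4 (`Transfer.diagonalInt_of_prop36`).
[cite: NesterenkoPhilippon2001, Ch. 3 Theorem 2.3 (p. 32) and proof of Lemma 2.2 (p. 37); Ch. 10 Prop. 3.6, §4] -/
theorem ramanujan_diagonalInt_multiplicity :
    ∃ c N₀ : ℕ, ∀ N : ℕ, N₀ ≤ N → ∀ A : MvPolynomial (Fin 4) ℤ, A ≠ 0 →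
      (∀ i, A.degreeOf i ≤ N) → (ramanujanComposite A).order ≤ ((c * N ^ 4 : ℕ) : ℕ∞) := by
  obtain ⟨lam, hlam, h36⟩ := Transfer.prop36
  exact Transfer.diagonalInt_of_prop36 hlam h36

/-- **LNM 1752 Ch. 3 Lemma 2.2 (Nesterenko), discharged**: for `0 < |q| < 1` there are constants
`γ₀ > 0`, `γ₂ > γ₁ > 0`, an `N₀` and polynomials `A_N ∈ ℤ[z, x₁, x₂, x₃]` (`N ≥ N₀`) with
`deg A_N ≤ γ₀ N log N`, `log H(A_N) ≤ γ₀ N log² N` and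
`exp(−γ₂N⁴) ≤ |A_N(q, P(q), Q(q), R(q))| ≤ exp(−γ₁N⁴)`. Printed proof: Lemmas 3.1, 3.4 and
"Theorem 2.3 applied with `L₁ = L₂ = N`"; here Lemma 3.1 (`…_lemma_3_1_holds`), Lemma 3.4
(`…_lemma_3_4_holds`) and (DIAG) (`ramanujan_diagonalInt_multiplicity`) are theorems of the tree.
[cite: NesterenkoPhilippon2001, Ch. 3 Lemma 2.2 (p. 31); proof §3 p. 37] -/
theorem NesterenkoPhilippon2001_ch3_lemma_2_2_holds : NesterenkoPhilippon2001_ch3_lemma_2_2 :=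
  NesterenkoPhilippon2001_ch3_lemma_2_2_of_diagonalInt ramanujan_diagonalInt_multiplicity

/-! ### The diagonal case of Theorem 2.3 over `ℂ` -/

/-- `Φ` is additive over finite sums. [folklore] -/
theorem ramanujanComposite_finset_sum {K : Type*} [CommRing K] {ι : Type*} (S : Finset ι)
    (f : ι → MvPolynomial (Fin 4) K) :
    ramanujanComposite (∑ i ∈ S, f i) = ∑ i ∈ S, ramanujanComposite (f i) :=
  map_sum (MvPolynomial.aeval _) f S

/-- `Φ` is multiplicative. [folklore] -/
theorem ramanujanComposite_mul {K : Type*} [CommRing K] (A B : MvPolynomial (Fin 4) K) :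
    ramanujanComposite (A * B) = ramanujanComposite A * ramanujanComposite B :=
  map_mul (MvPolynomial.aeval _) A B

/-- `Φ(C a) = C a`. [folklore] -/
theorem ramanujanComposite_C {K : Type*} [CommRing K] (a : K) :
    ramanujanComposite (C a : MvPolynomial (Fin 4) K) = PowerSeries.C a := by
  rw [ramanujanComposite, MvPolynomial.aeval_C, ← PowerSeries.C_eq_algebraMap]

/-- `Φ` of a monomial in terms of the integer structure series `Φ_ℤ(z^{s₀} x^{s̄})`. [folklore] -/
theorem ramanujanComposite_monomial_eq_C_mul_map {K : Type*} [CommRing K] (s : Fin 4 →₀ ℕ) (a : K) :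
    ramanujanComposite (monomial s a) =
      PowerSeries.C a * (ramanujanComposite (monomial s (1 : ℤ))).map (Int.castRingHom K) := by
  rw [← ramanujanComposite_map, map_monomial, map_one,
    show monomial s a = C a * monomial s 1 by rw [C_mul_monomial, mul_one],
    ramanujanComposite_mul, ramanujanComposite_C]

/-- Coefficients of `Φ(∑ monomials)`: integer structure constants `d(s, n)` (the Taylor
coefficients of `Φ_ℤ(z^{s₀} x̲^{s̄})`), whatever the coefficient ring. [folklore] -/
theorem coeff_ramanujanComposite_sum_monomial {K : Type*} [CommRing K] (S : Finset (Fin 4 →₀ ℕ))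
    (g : (Fin 4 →₀ ℕ) → K) (n : ℕ) {d : (Fin 4 →₀ ℕ) → ℤ}
    (hd : ∀ s, d s = PowerSeries.coeff n (ramanujanComposite (monomial s (1 : ℤ)))) :
    PowerSeries.coeff n (ramanujanComposite (∑ s ∈ S, monomial s (g s))) =
      ∑ s ∈ S, g s * (d s : K) := by
  rw [ramanujanComposite_finset_sum, map_sum]
  refine Finset.sum_congr rfl fun s _ => ?_
  rw [ramanujanComposite_monomial_eq_C_mul_map, PowerSeries.coeff_C_mul, PowerSeries.coeff_map,
    eq_intCast, hd]

/-- **Rational structure of the order condition**: if a non-zero `A ∈ ℂ[z, x̲]` has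
`Φ(A) = A(z, P, Q, R)` vanishing to order `> B`, then so does some non-zero `A' ∈ ℤ[z, x̲]` with
`supp A' ⊆ supp A` (the conditions are linear equations with integer coefficients in the
coefficients of `A`; apply a `ℚ`-linear functional `ℂ → ℚ` non-zero on one coefficient and clear
denominators). [folklore] -/
theorem exists_int_of_coeff_ramanujanComposite_eq_zero (A : MvPolynomial (Fin 4) ℂ) (hA : A ≠ 0)
    (B : ℕ) (hvan : ∀ n ≤ B, PowerSeries.coeff n (ramanujanComposite A) = 0) :
    ∃ A' : MvPolynomial (Fin 4) ℤ, A' ≠ 0 ∧ A'.support ⊆ A.support ∧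
      ∀ n ≤ B, PowerSeries.coeff n (ramanujanComposite A') = 0 := by
  classical
  obtain ⟨s₀, hs₀⟩ := MvPolynomial.ne_zero_iff.mp hA
  obtain ⟨φ, hφ⟩ : ∃ φ : Module.Dual ℚ ℂ, φ (A.coeff s₀) ≠ 0 := by
    by_contra h
    push Not at h
    exact hs₀ ((Module.forall_dual_apply_eq_zero_iff ℚ (A.coeff s₀)).mp h)
  -- clear the denominators of the finitely many rationals `φ (coeff s A)`
  obtain ⟨b, hb⟩ := IsLocalization.exist_integer_multiples_of_finset (nonZeroDivisors ℤ)
    (A.support.image fun s => φ (A.coeff s))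
  have hint : ∀ s ∈ A.support, ∃ z : ℤ, (z : ℚ) = (b : ℤ) * φ (A.coeff s) := by
    intro s hs
    obtain ⟨z, hz⟩ := hb _ (Finset.mem_image_of_mem _ hs)
    refine ⟨z, ?_⟩
    rw [Algebra.smul_def] at hz
    simpa using hz
  choose! z hz using hint
  have hb0 : ((b : ℤ) : ℚ) ≠ 0 := by exact_mod_cast nonZeroDivisors.coe_ne_zero b
  refine ⟨∑ s ∈ A.support, monomial s (z s), ?_, ?_, ?_⟩
  · -- non-zero: the coefficient at `s₀` is `z s₀`, and `(z s₀ : ℚ) = b φ(a_{s₀}) ≠ 0`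
    intro h0
    have hc : coeff s₀ (∑ s ∈ A.support, monomial s (z s)) = z s₀ := by
      rw [coeff_sum]
      simp only [coeff_monomial]
      rw [Finset.sum_ite_eq' A.support s₀ z, if_pos (mem_support_iff.mpr hs₀)]
    rw [h0, coeff_zero] at hc
    have : (z s₀ : ℚ) = 0 := by rw [← hc]; simp
    rw [hz s₀ (mem_support_iff.mpr hs₀)] at this
    exact (mul_ne_zero hb0 hφ) this
  · -- support
    intro m hm
    obtain ⟨s, hs, hms⟩ := Finset.mem_biUnion.mp (support_sum hm)
    rw [support_monomial] at hms
    split_ifs at hms with h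
    · exact absurd hms (Finset.notMem_empty _)
    · rw [Finset.mem_singleton.mp hms]; exact hs
  · -- vanishing of the first coefficients
    intro n hn
    obtain ⟨d, hd⟩ : ∃ d : (Fin 4 →₀ ℕ) → ℤ,
        ∀ s, d s = PowerSeries.coeff n (ramanujanComposite (monomial s (1 : ℤ))) := ⟨_, fun _ => rfl⟩
    have hC := hvan n hn
    conv_lhs at hC => rw [A.as_sum]
    rw [coeff_ramanujanComposite_sum_monomial _ _ n hd] at hC ⊢
    -- `hC : ∑ a_s d_s = 0` in `ℂ`; apply `φ` and multiply by `b`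
    have hq : ((∑ s ∈ A.support, z s * (d s : ℤ) : ℤ) : ℚ) =
        (b : ℤ) * φ (∑ s ∈ A.support, A.coeff s * (d s : ℂ)) := by
      rw [map_sum, Finset.mul_sum]
      push_cast
      refine Finset.sum_congr rfl fun s hs => ?_
      rw [hz s hs, show A.coeff s * ((d s : ℤ) : ℂ) = (d s) • A.coeff s by rw [zsmul_eq_mul, mul_comm],
        map_zsmul, zsmul_eq_mul]
      ring
    rw [hC, map_zero, mul_zero] at hq
    have h0 : ∑ s ∈ A.support, z s * d s = 0 := by exact_mod_cast hq
    simpa using h0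

/-- **(DIAG) over `ℤ` implies the diagonal multiplicity estimate over `ℂ`** (for all `N ≥ 1`, the
finitely many `N` below the threshold being absorbed into the constant): the order condition is
`ℚ`-rational (`exists_int_of_coeff_ramanujanComposite_eq_zero`).
[cite: NesterenkoPhilippon2001, Ch. 3 Theorem 2.3 (p. 32); Ch. 10 Theorem 1.3 (p. 151)] -/
theorem ramanujan_diagonal_multiplicity_of_diagonalInt (hInt : ∃ c N₀ : ℕ, ∀ N : ℕ, N₀ ≤ N → ∀ A : MvPolynomial (Fin 4) ℤ, A ≠ 0 →
      (∀ i, A.degreeOf i ≤ N) → (ramanujanComposite A).order ≤ ((c * N ^ 4 : ℕ) : ℕ∞)) :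
    ∃ c : ℕ, ∀ N : ℕ, 1 ≤ N → ∀ A : MvPolynomial (Fin 4) ℂ, A ≠ 0 →
      (∀ i, A.degreeOf i ≤ N) → (ramanujanComposite A).order ≤ ((c * N ^ 4 : ℕ) : ℕ∞) := by
  classical
  obtain ⟨c, N₀, h⟩ := hInt
  refine ⟨c * (N₀ + 1) ^ 4, fun N hN A hA hdeg => ?_⟩
  set Bd : ℕ := c * (N₀ + 1) ^ 4 * N ^ 4 with hBd
  by_contra hlt
  have hlt' : ((Bd : ℕ) : ℕ∞) < (ramanujanComposite A).order := not_le.mp hlt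
  have hvan : ∀ n ≤ Bd, PowerSeries.coeff n (ramanujanComposite A) = 0 := fun n hn =>
    PowerSeries.coeff_of_lt_order n (lt_of_le_of_lt (Nat.cast_le.mpr hn) hlt')
  obtain ⟨A', hA'0, hsupp, hvan'⟩ := exists_int_of_coeff_ramanujanComposite_eq_zero A hA Bd hvan
  have hdeg' : ∀ i, A'.degreeOf i ≤ max N N₀ := fun i =>
    (degreeOf_le_iff.mpr fun m hm => degreeOf_le_iff.mp (hdeg i) m (hsupp hm)).trans (le_max_left _ _)
  have hord := h (max N N₀) (le_max_right _ _) A' hA'0 hdeg'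
  have hmax : max N N₀ ≤ (N₀ + 1) * N := by
    rcases le_total N N₀ with hle | hle
    · rw [max_eq_right hle]; nlinarith
    · rw [max_eq_left hle]; nlinarith
  have hle : c * (max N N₀) ^ 4 ≤ Bd := by
    calc c * (max N N₀) ^ 4 ≤ c * ((N₀ + 1) * N) ^ 4 :=
          Nat.mul_le_mul_left c (Nat.pow_le_pow_left hmax 4)
      _ = Bd := by rw [hBd]; ring
  have hbig : ((Bd + 1 : ℕ) : ℕ∞) ≤ (ramanujanComposite A').order :=
    PowerSeries.nat_le_order _ _ fun i hi => hvan' i (Nat.lt_succ_iff.mp hi)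
  have : ((Bd + 1 : ℕ) : ℕ∞) ≤ ((c * (max N N₀) ^ 4 : ℕ) : ℕ∞) := hbig.trans hord
  have : Bd + 1 ≤ c * (max N N₀) ^ 4 := by exact_mod_cast this
  omega

/-- **The diagonal multiplicity estimate over `ℂ`, unconditionally** (the case `L₁ = L₂ = N` of
LNM 1752 Ch. 3 Theorem 2.3 = Ch. 10 Theorem 1.3, for every `N ≥ 1` and every non-zero
`A ∈ ℂ[z, x₁, x₂, x₃]` with `deg_z A, deg_{xᵢ} A ≤ N`: `ord_{z=0} A(z, P, Q, R) ≤ c N⁴` with an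
absolute `c`): (DIAG) over `ℤ` (`ramanujan_diagonalInt_multiplicity`, from Prop. 3.6 of Ch. 10) and
the rationality of the order condition (`ramanujan_diagonal_multiplicity_of_diagonalInt`).
[cite: NesterenkoPhilippon2001, Ch. 3 Theorem 2.3 (p. 32); Ch. 10 Theorem 1.3 (p. 151), Prop. 3.6, §4]
[cite: Nesterenko1996SbMath, Theorem 3] -/
theorem ramanujan_diagonal_multiplicity :
    ∃ c : ℕ, ∀ N : ℕ, 1 ≤ N → ∀ A : MvPolynomial (Fin 4) ℂ, A ≠ 0 →
      (∀ i, A.degreeOf i ≤ N) → (ramanujanComposite A).order ≤ ((c * N ^ 4 : ℕ) : ℕ∞) :=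
  ramanujan_diagonal_multiplicity_of_diagonalInt ramanujan_diagonalInt_multiplicity

/-- **Theorem 2.3 of Ch. 3 with `max(L₁, L₂)⁴` in place of `L₁ L₂³`** (PROVED; the printed
bi-degree shape `c L₁ L₂³` of the named fact `NesterenkoPhilippon2001_ch3_thm_2_3` is sharper off the
diagonal and remains un-discharged): for all `L₁, L₂ ≥ 1` and every non-zero `A ∈ ℂ[z, x₁, x₂, x₃]`
with `deg_z A ≤ L₁`, `deg_{xᵢ} A ≤ L₂`, `ord_{z=0} A(z, P, Q, R) ≤ c · max(L₁, L₂)⁴`.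
[cite: NesterenkoPhilippon2001, Ch. 3 Theorem 2.3 (p. 32)] [cite: Nesterenko1996SbMath, Theorem 3] -/
theorem ramanujan_multiplicity_max_pow_four :
    ∃ c : ℕ, ∀ (L₁ L₂ : ℕ), 1 ≤ L₁ → 1 ≤ L₂ → ∀ A : MvPolynomial (Fin 4) ℂ, A ≠ 0 →
      A.degreeOf 0 ≤ L₁ → A.degreeOf 1 ≤ L₂ → A.degreeOf 2 ≤ L₂ → A.degreeOf 3 ≤ L₂ →
      (ramanujanComposite A).order ≤ ((c * (max L₁ L₂) ^ 4 : ℕ) : ℕ∞) := by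
  obtain ⟨c, hc⟩ := ramanujan_diagonal_multiplicity
  refine ⟨c, fun L₁ L₂ h₁ _ A hA hd0 hd1 hd2 hd3 => hc (max L₁ L₂) (h₁.trans (le_max_left _ _)) A hA ?_⟩
  intro i
  fin_cases i
  · exact hd0.trans (le_max_left _ _)
  · exact hd1.trans (le_max_right _ _)
  · exact hd2.trans (le_max_right _ _)
  · exact hd3.trans (le_max_right _ _)

/-! ### Why "three": no `k = 3` sequence at a point with an algebraic coordinate -/

/-- **If one coordinate of `ω̄ = (q, P(q), Q(q), R(q))` is algebraic, then
`trdeg_ℚ ℚ(q, P(q), Q(q), R(q)) ≤ 3`** (the other three generate the field up to an algebraic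
extension). With Theorem 1.1 this is an equality: at every algebraic `q` (Cor. 1.4) and at the CM
points with `Q(q) = 0` or `R(q) = 0`. [cite: NesterenkoPhilippon2001, Ch. 3 Theorem 1.1 and Corollary 1.4 (pp. 27–28)] -/
theorem trdeg_adjoin_ramanujanPoint_le_three_of_isAlgebraic {q : ℂ} {i : Fin 4}
    (hi : IsAlgebraic ℚ (ramanujanPoint q i)) :
    Algebra.trdeg ℚ (adjoin ℚ (Set.range (ramanujanPoint q))) ≤ (3 : Cardinal) := by
  have hsub : Set.range (ramanujanPoint q) ⊆
      Set.range (ramanujanPoint q ∘ i.succAbove) ∪ {ramanujanPoint q i} := by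
    rintro _ ⟨j, rfl⟩
    by_cases hj : j = i
    · subst hj
      exact Or.inr rfl
    · obtain ⟨k, hk⟩ := Fin.exists_succAbove_eq hj
      exact Or.inl ⟨k, by simp [Function.comp, hk]⟩
  have hle : adjoin ℚ (Set.range (ramanujanPoint q)) ≤
      adjoin ℚ (Set.range (ramanujanPoint q ∘ i.succAbove) ∪ {ramanujanPoint q i}) :=
    adjoin.mono ℚ _ _ hsub
  calc Algebra.trdeg ℚ (adjoin ℚ (Set.range (ramanujanPoint q)))
      ≤ Algebra.trdeg ℚ (adjoin ℚ (Set.range (ramanujanPoint q ∘ i.succAbove) ∪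
          {ramanujanPoint q i})) :=
        trdeg_le_of_injective (inclusion hle) (inclusion_injective hle)
    _ = Algebra.trdeg ℚ (adjoin ℚ (Set.range (ramanujanPoint q ∘ i.succAbove))) :=
        trdeg_adjoin_union_eq_of_isAlgebraic _ _ (fun x hx => by
          rw [Set.mem_singleton_iff.mp hx]; exact hi)
    _ ≤ (3 : Cardinal) := by
        exact_mod_cast Philippon1986_criterion.trdeg_adjoin_range_le (ramanujanPoint q ∘ i.succAbove)

/-- At an algebraic `q`, `trdeg_ℚ ℚ(q, P(q), Q(q), R(q)) ≤ 3` (so Theorem 1.1 is sharp there: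
Corollary 1.4). [cite: NesterenkoPhilippon2001, Ch. 3 Corollary 1.4 (p. 28)] -/
theorem trdeg_adjoin_ramanujanPoint_le_three_of_isAlgebraic_q {q : ℂ} (hq : IsAlgebraic ℚ q) :
    Algebra.trdeg ℚ (adjoin ℚ (Set.range (ramanujanPoint q))) ≤ (3 : Cardinal) :=
  trdeg_adjoin_ramanujanPoint_le_three_of_isAlgebraic (i := 0) (by simpa [ramanujanPoint] using hq)

/-- **At `q₀ = e^{−2π}` the bound of Theorem 1.1 is attained: `trdeg_ℚ ℚ(q₀, P(q₀), Q(q₀), R(q₀)) = 3`**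
(`R(e^{−2π}) = 0`, `ramanujan_values_exp_neg_two_pi_holds`; `≥ 3` is Theorem 1.1,
`nesterenko1996_thm_1_1_holds`). [cite: NesterenkoPhilippon2001, Ch. 3 Theorem 1.1 and the values at `e^{−2π}` (p. 27)] -/
theorem trdeg_adjoin_ramanujanPoint_exp_neg_two_pi :
    Algebra.trdeg ℚ (adjoin ℚ (Set.range (ramanujanPoint ((Real.exp (-(2 * Real.pi)) : ℝ) : ℂ)))) =
      (3 : Cardinal) := by
  have hR := ramanujan_values_exp_neg_two_pi_holds.2.2
  refine le_antisymm ?_ ?_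
  · refine trdeg_adjoin_ramanujanPoint_le_three_of_isAlgebraic (i := 3) ?_
    simp only [ramanujanPoint, Matrix.cons_val]
    rw [hR]
    exact isAlgebraic_zero
  · have hpos : 0 < Real.exp (-(2 * Real.pi)) := Real.exp_pos _
    have hq0 : 0 < ‖((Real.exp (-(2 * Real.pi)) : ℝ) : ℂ)‖ := by
      rw [Complex.norm_real, Real.norm_eq_abs, abs_of_pos hpos]; exact hpos
    have hq1 : ‖((Real.exp (-(2 * Real.pi)) : ℝ) : ℂ)‖ < 1 := by
      rw [Complex.norm_real, Real.norm_eq_abs, abs_of_pos hpos, Real.exp_lt_one_iff]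
      linarith [Real.pi_pos]
    have h3 := nesterenko1996_thm_1_1_holds _ hq0 hq1
    have hle : adjoin ℚ ({((Real.exp (-(2 * Real.pi)) : ℝ) : ℂ),
          ramanujanP ((Real.exp (-(2 * Real.pi)) : ℝ) : ℂ), ramanujanQ ((Real.exp (-(2 * Real.pi)) : ℝ) : ℂ),
          ramanujanR ((Real.exp (-(2 * Real.pi)) : ℝ) : ℂ)} : Set ℂ) ≤
        adjoin ℚ (Set.range (ramanujanPoint ((Real.exp (-(2 * Real.pi)) : ℝ) : ℂ))) :=
      le_of_eq (by rw [range_ramanujanPoint])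
    exact h3.trans (trdeg_le_of_injective (inclusion hle) (inclusion_injective hle))

/-- **A sequence as in Theorem 2.1 with `k = 3` at `ω̄(q)` forces `trdeg ≥ 4`** (Theorem 2.1 is a
theorem of the tree, `NesterenkoPhilippon2001_ch3_thm_2_1_holds`): polynomials `A_N ∈ ℤ[z, x̲]` with
`deg A_N, log H(A_N) ≤ τ(N)`, `exp(−γ₂λ(N)) ≤ |A_N(ω̄(q))| ≤ exp(−γ₁λ(N))`, `λ(N+1)/λ(N) → 1` and
`λ(N)/τ(N)⁴ → ∞`. Lemma 2.2 supplies only `λ/τ³ → ∞` (`λ = N⁴`, `τ = γ₀ N log² N`).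
[cite: NesterenkoPhilippon2001, Ch. 3 Theorem 2.1 and Lemma 2.2 (p. 31)] -/
theorem four_le_trdeg_of_sequence {q : ℂ} {γ₁ γ₂ : ℝ} {τ lam : ℕ → ℝ}
    {A : ℕ → MvPolynomial (Fin 4) ℤ} (h₁ : 0 < γ₁) (h₁₂ : γ₁ < γ₂) (hτm : Monotone τ)
    (hlm : Monotone lam) (hτ : Tendsto τ atTop atTop) (hl : Tendsto lam atTop atTop)
    (hd : Tendsto (fun N => lam (N + 1) / lam N) atTop (𝓝 1))
    (hr : Tendsto (fun N => lam N / τ N ^ 4) atTop atTop)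
    (hdeg : ∀ N, ((A N).totalDegree : ℝ) ≤ τ N)
    (hH : ∀ N, Real.log (mvPolyHeight (A N) : ℝ) ≤ τ N)
    (hlo : ∀ N, Real.exp (-(γ₂ * lam N)) ≤ ‖aeval (ramanujanPoint q) (A N)‖)
    (hup : ∀ N, ‖aeval (ramanujanPoint q) (A N)‖ ≤ Real.exp (-(γ₁ * lam N))) :
    (4 : Cardinal) ≤ Algebra.trdeg ℚ (adjoin ℚ (Set.range (ramanujanPoint q))) := by
  have h := NesterenkoPhilippon2001_ch3_thm_2_1_holds 4 (ramanujanPoint q) 3 γ₁ γ₂ τ lam A h₁ h₁₂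
    hτm hlm hτ hl hd hr hdeg hH hlo hup
  exact_mod_cast h

/-- **No `k = 3` sequence exists at `ω̄(q)` when one coordinate of `ω̄(q)` is algebraic** — in
particular at every algebraic `q` and at the CM points with `Q(q) = 0` or `R(q) = 0`: the exponent
`4 = #{z, P, Q, R}` of Lemma 2.2 cannot be improved to `λ/τ⁴ → ∞` by any construction valid at such
a point, whatever the degrees and heights of the auxiliary polynomials ("we choose `n = 4, k = 2`").
[cite: NesterenkoPhilippon2001, Ch. 3 Theorem 2.1, Lemma 2.2 (p. 31) and Corollary 1.4 (p. 28)]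
[cite: Fonseca2019IntegralCurves, Theorem 1.2 and §1.4] -/
theorem not_exists_sequence_of_isAlgebraic {q : ℂ} {i : Fin 4}
    (hi : IsAlgebraic ℚ (ramanujanPoint q i)) :
    ¬ ∃ (γ₁ γ₂ : ℝ) (τ lam : ℕ → ℝ) (A : ℕ → MvPolynomial (Fin 4) ℤ),
      0 < γ₁ ∧ γ₁ < γ₂ ∧ Monotone τ ∧ Monotone lam ∧ Tendsto τ atTop atTop ∧
      Tendsto lam atTop atTop ∧ Tendsto (fun N => lam (N + 1) / lam N) atTop (𝓝 1) ∧
      Tendsto (fun N => lam N / τ N ^ 4) atTop atTop ∧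
      (∀ N, ((A N).totalDegree : ℝ) ≤ τ N) ∧
      (∀ N, Real.log (mvPolyHeight (A N) : ℝ) ≤ τ N) ∧
      (∀ N, Real.exp (-(γ₂ * lam N)) ≤ ‖aeval (ramanujanPoint q) (A N)‖) ∧
      (∀ N, ‖aeval (ramanujanPoint q) (A N)‖ ≤ Real.exp (-(γ₁ * lam N))) := by
  rintro ⟨γ₁, γ₂, τ, lam, A, h₁, h₁₂, hτm, hlm, hτ, hl, hd, hr, hdeg, hH, hlo, hup⟩
  have h4 := four_le_trdeg_of_sequence h₁ h₁₂ hτm hlm hτ hl hd hr hdeg hH hlo hup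
  have h3 := trdeg_adjoin_ramanujanPoint_le_three_of_isAlgebraic hi
  have h43 : (4 : Cardinal) ≤ 3 := h4.trans h3
  norm_num at h43

/-- **At `q₀ = e^{−2π}` no `k = 3` sequence exists** (`R(q₀) = 0`): the point behind Corollary 1.2
(`π, e^π, Γ(1/4)`) is one where the method's "three" is the truth.
[cite: NesterenkoPhilippon2001, Ch. 3 Theorem 2.1 (p. 31) and the values at `e^{−2π}` (p. 27)] -/
theorem not_exists_sequence_exp_neg_two_pi :
    ¬ ∃ (γ₁ γ₂ : ℝ) (τ lam : ℕ → ℝ) (A : ℕ → MvPolynomial (Fin 4) ℤ),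
      0 < γ₁ ∧ γ₁ < γ₂ ∧ Monotone τ ∧ Monotone lam ∧ Tendsto τ atTop atTop ∧
      Tendsto lam atTop atTop ∧ Tendsto (fun N => lam (N + 1) / lam N) atTop (𝓝 1) ∧
      Tendsto (fun N => lam N / τ N ^ 4) atTop atTop ∧
      (∀ N, ((A N).totalDegree : ℝ) ≤ τ N) ∧
      (∀ N, Real.log (mvPolyHeight (A N) : ℝ) ≤ τ N) ∧
      (∀ N, Real.exp (-(γ₂ * lam N)) ≤
        ‖aeval (ramanujanPoint ((Real.exp (-(2 * Real.pi)) : ℝ) : ℂ)) (A N)‖) ∧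
      (∀ N, ‖aeval (ramanujanPoint ((Real.exp (-(2 * Real.pi)) : ℝ) : ℂ)) (A N)‖ ≤
        Real.exp (-(γ₁ * lam N))) := by
  refine not_exists_sequence_of_isAlgebraic (i := 3) ?_
  simp only [ramanujanPoint, Matrix.cons_val]
  rw [ramanujan_values_exp_neg_two_pi_holds.2.2]
  exact isAlgebraic_zero

/-- **At an algebraic `q` (`0 < |q| < 1` not even needed) no `k = 3` sequence exists**: a proof of a
fourth algebraically independent number at a transcendental non-CM `q` through Theorem 2.1 must use
an input that fails at algebraic `q` — unlike Lemmas 3.1–3.4, which hold for every `0 < |q| < 1`.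
[cite: NesterenkoPhilippon2001, Ch. 3 Theorem 2.1 (p. 31), Corollary 1.4 (p. 28), Conjecture 1.11 (p. 30)] -/
theorem not_exists_sequence_of_isAlgebraic_q {q : ℂ} (hq : IsAlgebraic ℚ q) :
    ¬ ∃ (γ₁ γ₂ : ℝ) (τ lam : ℕ → ℝ) (A : ℕ → MvPolynomial (Fin 4) ℤ),
      0 < γ₁ ∧ γ₁ < γ₂ ∧ Monotone τ ∧ Monotone lam ∧ Tendsto τ atTop atTop ∧
      Tendsto lam atTop atTop ∧ Tendsto (fun N => lam (N + 1) / lam N) atTop (𝓝 1) ∧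
      Tendsto (fun N => lam N / τ N ^ 4) atTop atTop ∧
      (∀ N, ((A N).totalDegree : ℝ) ≤ τ N) ∧
      (∀ N, Real.log (mvPolyHeight (A N) : ℝ) ≤ τ N) ∧
      (∀ N, Real.exp (-(γ₂ * lam N)) ≤ ‖aeval (ramanujanPoint q) (A N)‖) ∧
      (∀ N, ‖aeval (ramanujanPoint q) (A N)‖ ≤ Real.exp (-(γ₁ * lam N))) :=
  not_exists_sequence_of_isAlgebraic (i := 0) (by simpa [ramanujanPoint] using hq)

end Literature.Barriers.Schanuel

end
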